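import Literature.NumberTheory.NumberFields.BauerSplitPrimes
import HarnessLib

/-!
# Prescribed decomposition groups: every cyclic subgroup of `Gal(L/F)` is a decomposition group,
# and the rigidity of "`c`-twisted" equivariant maps of primes

Topic `NumberTheory/NumberFields`. Theorem-only file (no definition, no named fact), unconditional: the
analytic input is the tree's proved Chebotarev existence theorem `infinite_setOf_exists_isArithFrobAt`.
Classical statements (Neukirch, *Algebraic Number Theory*, Ch. I §9 Prop. (9.4): at an unramified
prime of a Galois extension the decomposition group is cyclic, generated by the Frobenius; Ch. VII
Thm. (13.4), Chebotarev: every element of the Galois group is a Frobenius at infinitely many primes;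
Marcus, *Number Fields*, Ch. 4 Thm. 32) in the form consumed by the [FrdI] Thm. 6.4 (iv)
"general case" line of the abc-iut cell (GAP-LEDGER G-L1t3-1 #2, seats abc-iut-L1-d3 / abc-iut-w4-d090;
Mochizuki, *The geometry of Frobenioids I*, Thm. 6.4 (iv) p. 115, the compatibility clause "in a
fashion that is compatible with an isomorphism `F₁ ⥲ F₂`", whose proof in the non-Galois case runs
through primes with PRESCRIBED decomposition group; nothing of [FrdI] is asserted here):

* `stabilizer_eq_zpowers_of_isArithFrobAt` — `L/F` Galois, `q` unramified in `L`, `Q ∣ q`, `g` an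
  arithmetic Frobenius at `Q` ⇒ `Stab_{Gal(L/F)}(Q) = ⟨g⟩` (`#Stab = e·f = f`, `g ∈ Stab`, `g^f = 1`,
  and `f ∣ ord g` since `g^{ord g} = 1` acts as `x ↦ x^{q^{ord g}}` on `𝓞_L/Q` of order `q^f`);
* `infinite_setOf_exists_stabilizer_eq_zpowers` — **every cyclic subgroup `⟨g⟩ ≤ Gal(L/F)` is the
  decomposition group of infinitely many primes** (degree-one primes `q` of `F`, unramified in `L`,
  with some `Q ∣ q` of stabiliser exactly `⟨g⟩`); `exists_stabilizer_eq_zpowers`; the case `g = 1`,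
  `exists_stabilizer_eq_bot` (a prime of `𝓞_L` with TRIVIAL decomposition group);
* place forms over the tree's Galois action on `HeightOneSpectrum (𝓞 L)`
  (`Literature.NumberTheory.Automorphic.instMulActionHeightOneSpectrum`):
  `stabilizer_place_eq_zpowers_of_isArithFrobAt`, `exists_place_stabilizer_eq_zpowers`,
  `exists_place_stabilizer_eq_bot`, `mem_zpowers_of_twisted_equivariant_place`;
* `smul_eq_self_of_twisted_equivariant` (pure group action), `mem_zpowers_of_twisted_equivariant`,
  `twist_trivial_of_not_mem` (number fields) — **rigidity of `c`-twists**: if `c` commutes with `h`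
  and a self-map `π` of the primes of `𝓞_L` moves every prime inside its `c`-orbit
  (`π Q ∈ {Q, c • Q}`) and is equivariant for `h` twisted by `c` (`π (h • Q) = (h c) • π Q`), then `c`
  fixes every prime fixed by `h`, hence (at a prime with decomposition group exactly `⟨h⟩`) `c ∈ ⟨h⟩`.
  This is the closing step of the CM branch of the [FrdI] Thm. 6.4 (iv) general-case argument (`c` =
  complex conjugation, central in `Gal(L/ℚ)` for a Galois CM field `L`; `h ↦ h·c^{χ(h)}` the twist of
  `Gal(L/F₁)` read off the archimedean places): the twist is trivial unless `c ∈ Gal(L/F₁)`.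

Mathlib: `IsArithFrobAt(.mem_stabilizer)`, `Ideal.card_stabilizer_eq`, `Ideal.cardQuot_pow_inertiaDeg`,
`FiniteField.orderOf_frobeniusAlgHom`, `FiniteField.pow_card`.  Tree: `infinite_setOf_exists_isArithFrobAt`,
`inertia_eq_bot_of_isUnramifiedIn`; the residue-field computations of `ArtinNormSubgroup.lean` /
`ArtinFormalismInductionProofs.lean` are re-derived as private lemmas (same arguments) to keep the
imports inside the `BauerSplitPrimes` closure.  `lean search 'stabilizer_eq_zpowers|stabilizer_eq_bot'`:
summit-local special cases only (`Summits/Langlands/…EvenEpsilon.lean`), no Literature statement.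

## References

* J. Neukirch, *Algebraic Number Theory*, Grundlehren 322, Springer 1999, Ch. I §9 Prop. (9.4);
  Ch. VII Thm. (13.4). [NeukirchANT1999]
* D. A. Marcus, *Number Fields*, 2nd ed., Springer 2018, Ch. 4, Thm. 32 and remark. [Marcus2018]
* S. Mochizuki, *The geometry of Frobenioids I*, Kyushu J. Math. 62 (2008), Thm. 6.4 (iv) p. 115
  (locus served; nothing of it is asserted here). [MochizukiFrdI2008]
-/

noncomputable section

open NumberField IsDedekindDomain

open scoped Pointwise

namespace Literature.NumberTheory.NumberFields

open Literature.NumberTheory.GaloisRepresentations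

/-! ### Rigidity of `c`-twisted equivariant self-maps (pure group action) -/

section Twist

variable {G X : Type*} [Group G] [MulAction G X]

/-- **Rigidity of a `c`-twist, abstract form** (a step of OUR proof of the compatibility clause
of [FrdI] Thm. 6.4 (iv) in the non-Galois case — the CM branch, where `c` is complex conjugation and
`X` the set of places of the Galois CM field; not a statement of the source).  Let `G` act on `X`,
let `c h = h c`, and let `π : X → X` move every point inside its `c`-orbit (`π x = x ∨ π x = c • x`).
If `π` is "`h ↦ h c`-twisted equivariant" at a point `x` FIXED by `h` — `π (h • x) = (h * c) • π x` —
then `c` fixes `x`.  (Both cases `π x = x`, `π x = c • x` give `c • x = x` after cancelling `h`,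
resp. `c`.) [cite: MochizukiFrdI2008, Thm. 6.4 (iv) p.115] -/
theorem smul_eq_self_of_twisted_equivariant {c h : G} (hch : Commute c h) (π : X → X) {x : X}
    (hx : h • x = x) (hπx : π x = x ∨ π x = c • x) (hπ : π (h • x) = (h * c) • π x) :
    c • x = x := by
  have hinv : h⁻¹ • x = x := by
    conv_lhs => rw [← hx]
    rw [inv_smul_smul]
  rw [hx] at hπ
  rcases hπx with h1 | h1
  · -- `x = (h c) • x` ⇒ `c • x = h⁻¹ • x = x`
    rw [h1] at hπ
    have h2 : c • x = h⁻¹ • x := by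
      simpa only [mul_smul, inv_smul_smul] using (congrArg (h⁻¹ • ·) hπ).symm
    rw [h2, hinv]
  · -- `c • x = (h c) • (c • x) = c • (h • (c • x))`: cancel `c`, then `h`
    rw [h1] at hπ
    have h2 : c • x = c • (h • (c • x)) := by
      conv_lhs => rw [hπ]
      rw [← hch.eq, mul_smul]
    have h4 : h⁻¹ • x = c • x := by
      simpa only [inv_smul_smul] using congrArg (h⁻¹ • ·) (smul_left_cancel c h2)
    rw [← h4, hinv]

end Twist

/-! ### The decomposition group at an unramified prime is generated by the Frobenius -/

section Local

variable {F L : Type} [Field F] [NumberField F] [Field L] [NumberField L] [Algebra F L]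
  [IsGalois F L]

omit [NumberField F] [NumberField L] [IsGalois F L] in
/-- Iterates of an arithmetic Frobenius: `φᵏ x ≡ x^{qᵏ} (mod Q)` (adapted from the tree's
`pow_smul_sub_pow_mem_of_isArithFrobAt_ringOfIntegers`, `GaloisRepresentations/ArtinNormSubgroup.lean`).
[folklore] -/
private theorem pow_smul_sub_pow_mem {Q : Ideal (𝓞 L)} {φ : L ≃ₐ[F] L}
    (hφ : IsArithFrobAt (𝓞 F) φ Q) (k : ℕ) (x : 𝓞 L) :
    (φ ^ k) • x - x ^ (Nat.card (𝓞 F ⧸ Q.under (𝓞 F)) ^ k) ∈ Q := by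
  induction k with
  | zero => simp
  | succ k ih =>
    set q := Nat.card (𝓞 F ⧸ Q.under (𝓞 F)) with hq
    rw [pow_succ', mul_smul, pow_succ, pow_mul]
    have h1 : φ • ((φ ^ k) • x) - ((φ ^ k) • x) ^ q ∈ Q := by
      have h := hφ ((φ ^ k) • x)
      rwa [MulSemiringAction.toAlgHom_apply] at h
    have h2 : ((φ ^ k) • x) ^ q - (x ^ q ^ k) ^ q ∈ Q :=
      Ideal.mem_of_dvd Q (sub_dvd_pow_sub_pow _ _ q) ih
    have h3 := Q.add_mem h1 h2
    rwa [sub_add_sub_cancel] at h3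

omit [IsGalois F L] in
/-- `f(Q|q) ∣ m` as soon as `x^{q^m} = x` on the residue field `𝓞_L/Q` (the `q`-power Frobenius of
the residue extension has order exactly `f`, Mathlib `FiniteField.orderOf_frobeniusAlgHom`; adapted
from the tree's `inertiaDeg_dvd_of_forall_pow_residueCard_pow_eq`,
`GaloisRepresentations/ArtinFormalismInductionProofs.lean`). [folklore] -/
private theorem inertiaDeg_dvd_of_forall_pow_eq {q : HeightOneSpectrum (𝓞 F)} {Q : Ideal (𝓞 L)}
    (hQ : Q ∈ q.asIdeal.primesOver (𝓞 L)) {m : ℕ}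
    (h : ∀ x : 𝓞 L ⧸ Q, x ^ Nat.card (𝓞 F ⧸ q.asIdeal) ^ m = x) :
    Q.inertiaDeg (𝓞 F) ∣ m := by
  classical
  haveI := hQ.1
  haveI := hQ.2
  haveI : q.asIdeal.IsMaximal := q.isMaximal
  have hQne : Q ≠ ⊥ := Ideal.ne_bot_of_mem_primesOver q.ne_bot hQ
  haveI : Q.IsMaximal := Ideal.IsPrime.isMaximal hQ.1 hQne
  letI : Field (𝓞 F ⧸ q.asIdeal) := Ideal.Quotient.field _
  letI : Field (𝓞 L ⧸ Q) := Ideal.Quotient.field _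
  haveI : Finite (𝓞 F ⧸ q.asIdeal) := q.asIdeal.finiteQuotientOfFreeOfNeBot q.ne_bot
  haveI : Finite (𝓞 L ⧸ Q) := Q.finiteQuotientOfFreeOfNeBot hQne
  letI : Fintype (𝓞 F ⧸ q.asIdeal) := Fintype.ofFinite _
  have hq : Fintype.card (𝓞 F ⧸ q.asIdeal) = Nat.card (𝓞 F ⧸ q.asIdeal) :=
    Fintype.card_eq_nat_card
  have hf : Q.inertiaDeg (𝓞 F) = Module.finrank (𝓞 F ⧸ q.asIdeal) (𝓞 L ⧸ Q) :=
    Ideal.inertiaDeg_eq_of_isMaximal q.asIdeal Q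
  rw [hf, ← FiniteField.orderOf_frobeniusAlgHom (𝓞 F ⧸ q.asIdeal) (𝓞 L ⧸ Q)]
  refine orderOf_dvd_of_pow_eq_one (DFunLike.ext _ _ fun x => ?_)
  rw [AlgHom.coe_pow, FiniteField.coe_frobeniusAlgHom, pow_iterate, AlgHom.one_apply, hq]
  exact h x

/-- `#D_Q = f(Q|q)` at a prime unramified in a Galois extension (`#D_Q = e·f`, Mathlib
`Ideal.card_stabilizer_eq`, with `e = 1`; same proof as the tree's
`Literature.NumberTheory.Automorphic.HeightOneSpectrum.card_stabilizer_eq_inertiaDeg`). [folklore] -/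
private theorem card_stabilizer_ideal_eq_inertiaDeg {q : HeightOneSpectrum (𝓞 F)}
    (hunr : Algebra.IsUnramifiedIn (𝓞 L) q.asIdeal) {Q : Ideal (𝓞 L)}
    (hQ : Q ∈ q.asIdeal.primesOver (𝓞 L)) :
    Nat.card (MulAction.stabilizer (L ≃ₐ[F] L) Q) = Q.inertiaDeg (𝓞 F) := by
  haveI : Module.Finite (𝓞 F) (𝓞 L) := IsIntegralClosure.finite (𝓞 F) F L (𝓞 L)
  haveI : IsGaloisGroup (L ≃ₐ[F] L) (𝓞 F) (𝓞 L) := IsGaloisGroup.of_isFractionRing _ _ _ F L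
  haveI := hQ.1
  haveI := hQ.2
  haveI := q.isPrime
  rw [Ideal.card_stabilizer_eq (G := L ≃ₐ[F] L) q.asIdeal Q,
    Ideal.ramificationIdxIn_eq_ramificationIdx q.asIdeal Q (L ≃ₐ[F] L),
    Ideal.inertiaDegIn_eq_inertiaDeg q.asIdeal Q (L ≃ₐ[F] L),
    hunr.ramificationIdx_eq_one hQ.2, one_mul]

/-- **The decomposition group at an unramified prime is generated by the Frobenius** (Neukirch,
*Algebraic Number Theory*, Ch. I §9 Prop. (9.4); Marcus, *Number Fields*, Ch. 4 Thm. 32): for `L/F`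
Galois, `q` unramified in `L`, `Q ∣ q` a prime of `𝓞_L` and `g ∈ Gal(L/F)` an arithmetic Frobenius at
`Q`, `Stab_{Gal(L/F)}(Q) = ⟨g⟩` (`⟨g⟩ ≤ Stab(Q)`, `#Stab(Q) = f`, `g^f = 1` as it lies in the trivial
inertia group, and `f ∣ ord g`). [cite: NeukirchANT1999, Ch. I §9 Prop. (9.4)] -/
theorem stabilizer_eq_zpowers_of_isArithFrobAt {q : HeightOneSpectrum (𝓞 F)}
    (hunr : Algebra.IsUnramifiedIn (𝓞 L) q.asIdeal) {Q : Ideal (𝓞 L)}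
    (hQ : Q ∈ q.asIdeal.primesOver (𝓞 L)) {g : L ≃ₐ[F] L} (hg : IsArithFrobAt (𝓞 F) g Q) :
    MulAction.stabilizer (L ≃ₐ[F] L) Q = Subgroup.zpowers g := by
  classical
  haveI := hQ.1
  haveI := hQ.2
  haveI : q.asIdeal.IsMaximal := q.isMaximal
  have hQne : Q ≠ ⊥ := Ideal.ne_bot_of_mem_primesOver q.ne_bot hQ
  haveI hQmax : Q.IsMaximal := Ideal.IsPrime.isMaximal hQ.1 hQne
  have hunder : Q.under (𝓞 F) = q.asIdeal := hQ.2.over.symm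
  -- `#Stab(Q) = f`
  have hcard : Nat.card (MulAction.stabilizer (L ≃ₐ[F] L) Q) = Q.inertiaDeg (𝓞 F) :=
    card_stabilizer_ideal_eq_inertiaDeg hunr hQ
  -- `⟨g⟩ ≤ Stab(Q)`
  have hle : Subgroup.zpowers g ≤ MulAction.stabilizer (L ≃ₐ[F] L) Q := by
    rw [Subgroup.zpowers_le]
    exact hg.mem_stabilizer
  -- `q^f = #(𝓞 L ⧸ Q)`
  have hqf : Nat.card (𝓞 F ⧸ Q.under (𝓞 F)) ^ Q.inertiaDeg (𝓞 F) = Nat.card (𝓞 L ⧸ Q) := by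
    have h := Ideal.cardQuot_pow_inertiaDeg (q.asIdeal) Q (R := 𝓞 F)
    rw [Submodule.cardQuot_apply, Submodule.cardQuot_apply] at h
    rw [hunder]
    exact h
  -- `g^f = 1` (in the trivial inertia group)
  have h1 : g ^ Q.inertiaDeg (𝓞 F) = 1 := by
    have hmem : g ^ Q.inertiaDeg (𝓞 F) ∈ Q.inertia (L ≃ₐ[F] L) := by
      intro x
      have h := pow_smul_sub_pow_mem hg (Q.inertiaDeg (𝓞 F)) x
      rw [hqf] at h
      have hfrob : x ^ Nat.card (𝓞 L ⧸ Q) - x ∈ Q := by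
        rw [← Ideal.Quotient.eq, map_pow]
        letI := Ideal.Quotient.field Q
        haveI : Finite (𝓞 L ⧸ Q) := Ideal.finiteQuotientOfFreeOfNeBot Q hQne
        letI : Fintype (𝓞 L ⧸ Q) := Fintype.ofFinite _
        rw [Nat.card_eq_fintype_card]
        exact FiniteField.pow_card _
      have h3 := Q.add_mem h hfrob
      rwa [sub_add_sub_cancel] at h3
    rw [inertia_eq_bot_of_isUnramifiedIn hunr hQ, Subgroup.mem_bot] at hmem
    exact hmem
  -- `f ∣ ord g`
  have h2 : Q.inertiaDeg (𝓞 F) ∣ orderOf g := by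
    refine inertiaDeg_dvd_of_forall_pow_eq hQ fun x => ?_
    obtain ⟨y, rfl⟩ := Ideal.Quotient.mk_surjective x
    have h3 := pow_smul_sub_pow_mem hg (orderOf g) y
    rw [pow_orderOf_eq_one, one_smul, hunder] at h3
    rw [← map_pow, eq_comm, Ideal.Quotient.eq]
    exact h3
  have horder : orderOf g = Q.inertiaDeg (𝓞 F) :=
    Nat.dvd_antisymm (orderOf_dvd_of_pow_eq_one h1) h2
  symm
  apply Subgroup.eq_of_le_of_card_ge hle
  rw [hcard, Nat.card_zpowers, horder]

omit [NumberField F] [NumberField L] [IsGalois F L] in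
/-- The stabiliser of a finite PLACE `W` of `L` (the tree's action of `Gal(L/F)` on
`HeightOneSpectrum (𝓞 L)`, `Literature.NumberTheory.Automorphic.instMulActionHeightOneSpectrum`) is
the stabiliser of its prime ideal — the decomposition group `D_W` (same statement as the automorphic
layer's `HeightOneSpectrum.stabilizer_eq_stabilizer_asIdeal`, restated here to stay inside this
file's imports). [folklore] -/
private theorem stabilizer_place_eq_stabilizer_asIdeal (W : HeightOneSpectrum (𝓞 L)) :
    MulAction.stabilizer (L ≃ₐ[F] L) W = MulAction.stabilizer (L ≃ₐ[F] L) W.asIdeal :=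
  Subgroup.ext fun g => by
    simp only [MulAction.mem_stabilizer_iff, HeightOneSpectrum.ext_iff,
      Literature.NumberTheory.Automorphic.HeightOneSpectrum.smul_asIdeal]

/-- **Place form of Neukirch I (9.4)**: for a finite place `W` of `L` above `q` unramified in the
Galois extension `L/F` and an arithmetic Frobenius `g` at `𝔭_W`, the decomposition group of the PLACE
`W` (stabiliser for the action of `Gal(L/F)` on `HeightOneSpectrum (𝓞 L)`) is `⟨g⟩`.
[cite: NeukirchANT1999, Ch. I §9 Prop. (9.4)] -/
theorem stabilizer_place_eq_zpowers_of_isArithFrobAt {q : HeightOneSpectrum (𝓞 F)}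
    (hunr : Algebra.IsUnramifiedIn (𝓞 L) q.asIdeal) {W : HeightOneSpectrum (𝓞 L)}
    (hW : W.asIdeal ∈ q.asIdeal.primesOver (𝓞 L)) {g : L ≃ₐ[F] L}
    (hg : IsArithFrobAt (𝓞 F) g W.asIdeal) :
    MulAction.stabilizer (L ≃ₐ[F] L) W = Subgroup.zpowers g := by
  rw [stabilizer_place_eq_stabilizer_asIdeal, stabilizer_eq_zpowers_of_isArithFrobAt hunr hW hg]

end Local

/-! ### Every cyclic subgroup of `Gal(L/F)` is a decomposition group -/

section Global

variable {F L : Type} [Field F] [NumberField F] [Field L] [NumberField L] [Algebra F L]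
  [IsGalois F L]

/-- **Every cyclic subgroup `⟨g⟩ ≤ Gal(L/F)` is the decomposition group of infinitely many primes**
(Chebotarev's existence theorem at finite level — the tree's `infinite_setOf_exists_isArithFrobAt`,
Neukirch VII (13.4) — with `stabilizer_eq_zpowers_of_isArithFrobAt`): infinitely many degree-one
primes `q` of `F`, unramified in `L`, carry a prime `Q ∣ q` of `𝓞_L` with decomposition group
exactly `⟨g⟩`. [cite: NeukirchANT1999, Ch. VII Thm. (13.4)] -/
theorem infinite_setOf_exists_stabilizer_eq_zpowers (g : L ≃ₐ[F] L) :
    {q : HeightOneSpectrum (𝓞 F) | (Ideal.absNorm q.asIdeal).Prime ∧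
      Algebra.IsUnramifiedIn (𝓞 L) q.asIdeal ∧
      ∃ Q ∈ q.asIdeal.primesOver (𝓞 L), IsArithFrobAt (𝓞 F) g Q ∧
        MulAction.stabilizer (L ≃ₐ[F] L) Q = Subgroup.zpowers g}.Infinite := by
  refine (infinite_setOf_exists_isArithFrobAt g).mono ?_
  rintro q ⟨hprime, hunr, Q, hQ, hg⟩
  exact ⟨hprime, hunr, Q, hQ, hg, stabilizer_eq_zpowers_of_isArithFrobAt hunr hQ hg⟩

/-- Existence form: some prime `Q` of `𝓞_L`, above a degree-one prime of `F` unramified in `L`, has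
decomposition group exactly `⟨g⟩` and `g` as its Frobenius. [cite: NeukirchANT1999, Ch. VII Thm. (13.4)] -/
theorem exists_stabilizer_eq_zpowers (g : L ≃ₐ[F] L) :
    ∃ (q : HeightOneSpectrum (𝓞 F)) (Q : Ideal (𝓞 L)), (Ideal.absNorm q.asIdeal).Prime ∧
      Algebra.IsUnramifiedIn (𝓞 L) q.asIdeal ∧ Q ∈ q.asIdeal.primesOver (𝓞 L) ∧
      IsArithFrobAt (𝓞 F) g Q ∧ MulAction.stabilizer (L ≃ₐ[F] L) Q = Subgroup.zpowers g := by
  obtain ⟨q, hprime, hunr, Q, hQ, hg, hstab⟩ := (infinite_setOf_exists_stabilizer_eq_zpowers g).nonempty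
  exact ⟨q, Q, hprime, hunr, hQ, hg, hstab⟩

/-- **Primes with trivial decomposition group exist** (`g = 1`: a prime of `𝓞_L` above a degree-one
prime of `F` that splits completely in `L`). [cite: NeukirchANT1999, Ch. VII Thm. (13.4)] -/
theorem exists_stabilizer_eq_bot :
    ∃ (q : HeightOneSpectrum (𝓞 F)) (Q : Ideal (𝓞 L)), (Ideal.absNorm q.asIdeal).Prime ∧
      Algebra.IsUnramifiedIn (𝓞 L) q.asIdeal ∧ Q ∈ q.asIdeal.primesOver (𝓞 L) ∧
      MulAction.stabilizer (L ≃ₐ[F] L) Q = ⊥ := by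
  obtain ⟨q, Q, hprime, hunr, hQ, -, hstab⟩ := exists_stabilizer_eq_zpowers (1 : L ≃ₐ[F] L)
  exact ⟨q, Q, hprime, hunr, hQ, by rw [hstab, Subgroup.zpowers_one_eq_bot]⟩

omit [NumberField F] [NumberField L] [IsGalois F L] in
/-- At a prime with trivial decomposition group `Gal(L/F)` acts freely: `σ • Q = Q ↔ σ = 1` (for the
consumers of `exists_stabilizer_eq_bot` in OUR proof of the [FrdI] Thm. 6.4 (iv) clause).
[cite: MochizukiFrdI2008, Thm. 6.4 (iv) p.115] -/
theorem smul_eq_iff_eq_one_of_stabilizer_eq_bot {Q : Ideal (𝓞 L)}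
    (hQ : MulAction.stabilizer (L ≃ₐ[F] L) Q = ⊥) (σ : L ≃ₐ[F] L) : σ • Q = Q ↔ σ = 1 := by
  rw [← MulAction.mem_stabilizer_iff, hQ, Subgroup.mem_bot]

/-- **Place form**: every cyclic subgroup `⟨g⟩ ≤ Gal(L/F)` is the decomposition group of some
finite PLACE `W` of `L` (stabiliser for the action on `HeightOneSpectrum (𝓞 L)`), lying over a
degree-one prime of `F` unramified in `L`, with `g` the Frobenius at `𝔭_W`.
[cite: NeukirchANT1999, Ch. VII Thm. (13.4)] -/
theorem exists_place_stabilizer_eq_zpowers (g : L ≃ₐ[F] L) :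
    ∃ (q : HeightOneSpectrum (𝓞 F)) (W : HeightOneSpectrum (𝓞 L)), (Ideal.absNorm q.asIdeal).Prime ∧
      Algebra.IsUnramifiedIn (𝓞 L) q.asIdeal ∧ W.asIdeal ∈ q.asIdeal.primesOver (𝓞 L) ∧
      IsArithFrobAt (𝓞 F) g W.asIdeal ∧ MulAction.stabilizer (L ≃ₐ[F] L) W = Subgroup.zpowers g := by
  obtain ⟨q, Q, hprime, hunr, hQ, hg, hstab⟩ := exists_stabilizer_eq_zpowers (F := F) (L := L) g
  haveI : q.asIdeal.IsMaximal := q.isMaximal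
  have hQne : Q ≠ ⊥ := Ideal.ne_bot_of_mem_primesOver q.ne_bot hQ
  refine ⟨q, ⟨Q, hQ.1, hQne⟩, hprime, hunr, hQ, hg, ?_⟩
  rw [stabilizer_place_eq_stabilizer_asIdeal]
  exact hstab

/-- **Place form, `g = 1`**: some finite place of `L` has TRIVIAL decomposition group for the action of
`Gal(L/F)` on `HeightOneSpectrum (𝓞 L)` (a place above a degree-one prime of `F` that splits
completely in `L`). [cite: NeukirchANT1999, Ch. VII Thm. (13.4)] -/
theorem exists_place_stabilizer_eq_bot :
    ∃ (q : HeightOneSpectrum (𝓞 F)) (W : HeightOneSpectrum (𝓞 L)), (Ideal.absNorm q.asIdeal).Prime ∧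
      Algebra.IsUnramifiedIn (𝓞 L) q.asIdeal ∧ W.asIdeal ∈ q.asIdeal.primesOver (𝓞 L) ∧
      MulAction.stabilizer (L ≃ₐ[F] L) W = ⊥ := by
  obtain ⟨q, W, hprime, hunr, hW, -, hstab⟩ := exists_place_stabilizer_eq_zpowers (1 : L ≃ₐ[F] L)
  exact ⟨q, W, hprime, hunr, hW, by rw [hstab, Subgroup.zpowers_one_eq_bot]⟩

/-! ### Rigidity of `c`-twists for number fields -/

omit [NumberField F] [NumberField L] [IsGalois F L] in
/-- **A `c`-twisted equivariant, `c`-orbit-preserving map of primes forces `c ∈ ⟨h⟩`** — at the one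
prime that matters: if a prime `Q` of `𝓞_L` with decomposition group exactly `⟨h⟩`
(`exists_stabilizer_eq_zpowers`) has `π Q ∈ {Q, c • Q}` and `π (h • Q) = (h c) • π Q` for a self-map
`π` of the ideals and `c h = h c`, then `c ∈ ⟨h⟩` (so `c` fixes `Q`).  Step of OUR proof of the
[FrdI] Thm. 6.4 (iv) clause, CM branch (`c` = complex conjugation, central; it kills every
non-trivial value of the archimedean twist `χ : Gal(L/F₁) → ⟨c⟩` unless `c ∈ Gal(L/F₁)`); not a
statement of the source. [cite: MochizukiFrdI2008, Thm. 6.4 (iv) p.115] -/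
theorem mem_zpowers_of_twisted_equivariant_at {c h : L ≃ₐ[F] L} (hch : Commute c h)
    (π : Ideal (𝓞 L) → Ideal (𝓞 L)) {Q : Ideal (𝓞 L)}
    (hstab : MulAction.stabilizer (L ≃ₐ[F] L) Q = Subgroup.zpowers h)
    (hπc : π Q = Q ∨ π Q = c • Q) (hπh : π (h • Q) = (h * c) • π Q) :
    c ∈ Subgroup.zpowers h := by
  have hhQ : h • Q = Q := by
    rw [← MulAction.mem_stabilizer_iff, hstab]
    exact Subgroup.mem_zpowers h
  rw [← hstab, MulAction.mem_stabilizer_iff]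
  exact smul_eq_self_of_twisted_equivariant hch π hhQ hπc hπh

/-- **Place form of the twist rigidity**: the same for a self-map `π` of the finite PLACES of `L`
(action of `Gal(L/F)` on `HeightOneSpectrum (𝓞 L)`): `π W ∈ {W, c • W}` for all `W` and
`π (h • W) = (h c) • π W` for all `W`, with `c h = h c`, force `c ∈ ⟨h⟩` (step of OUR proof of the
[FrdI] Thm. 6.4 (iv) clause, CM branch; not a statement of the source).
[cite: MochizukiFrdI2008, Thm. 6.4 (iv) p.115] -/
theorem mem_zpowers_of_twisted_equivariant_place {c h : L ≃ₐ[F] L} (hch : Commute c h)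
    (π : HeightOneSpectrum (𝓞 L) → HeightOneSpectrum (𝓞 L))
    (hπc : ∀ W, π W = W ∨ π W = c • W) (hπh : ∀ W, π (h • W) = (h * c) • π W) :
    c ∈ Subgroup.zpowers h := by
  obtain ⟨q, W, -, -, -, -, hstab⟩ := exists_place_stabilizer_eq_zpowers (F := F) (L := L) h
  have hhW : h • W = W := by
    rw [← MulAction.mem_stabilizer_iff, hstab]
    exact Subgroup.mem_zpowers h
  rw [← hstab, MulAction.mem_stabilizer_iff]
  exact smul_eq_self_of_twisted_equivariant hch π hhW (hπc W) (hπh W)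

/-- **Consequence for a subgroup avoiding `c`.**  If `H ≤ Gal(L/F)` does not contain the central
element `c`, and a `c`-orbit-preserving self-map `π` of the primes is equivariant along the twist
`h ↦ h·c` for some `h ∈ H` (i.e. `π (h • Q) = (h c) • π Q` for all maximal `Q`), contradiction: so
along any `c`-orbit-preserving `π` that is `θ`-equivariant for a twist `θ(h) ∈ {h, h c}` of `H`, the
twist is trivial (`θ = id`), whence `θ(H) = H` (step of OUR proof of the [FrdI] Thm. 6.4 (iv)
clause, CM branch: `H = Gal(L/F₁)`, `c` = complex conjugation ∉ H; not a statement of the source).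
[cite: MochizukiFrdI2008, Thm. 6.4 (iv) p.115] -/
theorem twist_trivial_of_not_mem {H : Subgroup (L ≃ₐ[F] L)} {c : L ≃ₐ[F] L}
    (hc : c ∈ Subgroup.center (L ≃ₐ[F] L)) (hcH : c ∉ H)
    (π : Ideal (𝓞 L) → Ideal (𝓞 L))
    (hπc : ∀ Q : Ideal (𝓞 L), Q.IsMaximal → π Q = Q ∨ π Q = c • Q)
    (θ : H → L ≃ₐ[F] L) (hθ : ∀ h : H, θ h = h ∨ θ h = h * c)
    (hπθ : ∀ (h : H) (Q : Ideal (𝓞 L)), Q.IsMaximal → π ((h : L ≃ₐ[F] L) • Q) = θ h • π Q) :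
    ∀ h : H, θ h = h := by
  intro h
  rcases hθ h with h1 | h1
  · exact h1
  · exfalso
    have hch : Commute c (h : L ≃ₐ[F] L) := (Subgroup.mem_center_iff.mp hc h).symm
    obtain ⟨q, Q, -, -, hQ, -, hstab⟩ := exists_stabilizer_eq_zpowers (F := F) (h : L ≃ₐ[F] L)
    haveI : q.asIdeal.IsMaximal := q.isMaximal
    have hQmax : Q.IsMaximal :=
      Ideal.IsPrime.isMaximal hQ.1 (Ideal.ne_bot_of_mem_primesOver q.ne_bot hQ)
    have hmem : c ∈ Subgroup.zpowers (h : L ≃ₐ[F] L) :=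
      mem_zpowers_of_twisted_equivariant_at hch π hstab (hπc Q hQmax) (by rw [hπθ h Q hQmax, h1])
    exact hcH ((Subgroup.zpowers_le.mpr h.2) hmem)

end Global

end Literature.NumberTheory.NumberFields

end
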